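import Mathlib
import HarnessLib
import Summits.Ventures.LatticeQCDFlow.Exactness.U1PlaquetteLift
import Summits.Ventures.LatticeQCDFlow.Exactness.U1FTHMCMembers

/-!
# The engine's zero-parameter member: the masked Euler sub-steps of the U(1) Wilson flow are certified coupling layers of the gauge field, and FT-HMC through them — one sub-step or a whole schedule — is exact

HONEST FRAMING: exact (Metropolis-corrected) sampling algorithms for lattice gauge theory;
figures of merit are autocorrelation/cost numbers at stated couplings and volumes; no
continuum-physics claim.

Venture `LatticeQCDFlow` (cell pub-lqcd), topic `Exactness`; FANOUT row 14 (`eng-flowhmc`, engine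
`latflow.fthmc`, family B; member `maps.u1_wilson_flow_lo`, twin `ref_u1`).  NEW WORK of the cell;
nothing is cited as a fact; no number.  Third of three files (`WilsonFlowMasks` → `U1PlaquetteLift`
→ this).  The row's "LO Wilson-flow map (Lüscher t-expansion) as zero-parameter member" is, on the
U(1) rung, a SCHEDULE of masked Euler sub-steps of the U(1) Wilson flow
`θ̇_ℓ = −∂_ℓ Σ_P (1 − cos θ_P)`; the sub-step `(μ, class b)` (`χ` a proper colouring of the torus
— parity in the engine, which requires even sides: `WilsonFlowMasks.even_of_twoClassMask`) is

  `V(x,μ) ↦ V(x,μ) · exp(i ε Z_{x,μ}(V))` on the links with `χ x = b`, all other links unchanged,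
  `Z_{x,μ}(V) = Σ_{ν ≠ μ} [ Im P(V; x − ν̂, μ, ν) − Im P(V; x, μ, ν) ]`

(`P` = the tree's `plaquetteHolonomy` on `GaugeConfig d L Circle`; the code's
`Z_l = Σ_ν [−sin θ_P⁺ + sin θ_P⁻]`), computed from the CURRENT field, booking the log-det
`Σ_active log(1 − ε C_{x,μ}(V))`, `C = Σ_{ν ≠ μ} [Re P(x,μ,ν) + Re P(x−ν̂,μ,ν)]`, under the refusal
rule `κ = 2(d−1)|ε| < 1` (X-8).  Everything below is stated for these explicit expressions.

## Content (statements about explicit expressions; no definition is introduced)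

* **`exists_measurableEquiv_u1WilsonFlowLOSubstep`** — THE SUB-STEP IS A CERTIFIED LAYER: for a
  proper colouring `χ`, any direction `μ`, class `b` and `2(d−1)|ε| < 1` there is a measurable
  equivalence `F` of `GaugeConfig d L Circle` whose forward map IS the sub-step above and which
  has `HasJacobian (⊗_e Haar) F (∏_{active (x,μ)} (1 − ε C_{x,μ}))` — the exponential of exactly
  the log-det the engine books — positive and measurable.  Assembly: the sub-step is
  `Theory2.coupleFun` of an explicit single-link family (`WilsonFlowMasks.coupleFun_maskedUpdate`
  with the locality `U1PlaquetteLift.u1Substep_local`); that family consists of `C¹` degree-one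
  circle maps (`U1PlaquetteLift.hasDerivAt_plaquetteLift`, …) so
  `DegreeOneLayerEquiv.exists_coupleEquiv_of_hasDerivAt_pos` makes it a `Theory2.coupleEquiv`
  and `CircleGroupJacobian.hasJacobian_coupleFun_circleGroup_of_degreeOne` certifies its
  Jacobian, identified with the booked product by `WilsonFlowMasks.coupleJac_maskedUpdate`.
* **`u1_fthmc_leapfrog_gaussian_exact_wilsonFlowLOSubstep`** — FT-HMC exactly as the engine runs
  it (Gaussian refresh, leapfrog with `V_e ← e^{icp_e} V_e` and ANY measurable force, flip,
  Metropolis on `(S ∘ F − log J) + Σ_e p_e²/2`, report `F V`) through one sub-step leaves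
  `e^{−S} · ⊗_e Haar` invariant, for every measurable action `S`
  (`GaugeFTHMCLeapfrog.u1_fthmc_leapfrog_gaussian_exact`).
* **`exists_layers_u1WilsonFlowLO`** — any SCHEDULE (list of `(μ, class)`; the engine's is
  sweep-major, `μ`-major, parity even then odd, `n_sweeps` times) is a list of certified layers
  whose forward maps are the sub-steps and whose Jacobians are the booked products;
  **`u1_fthmc_leapfrog_gaussian_exact_wilsonFlowLO`** — hence FT-HMC through the whole
  leading-order member with its running log-det is exact
  (`U1FTHMCMembers.u1_fthmc_leapfrog_gaussian_exact_foldr`).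

NOT here: that the flow time `t = β/4` trivialises to leading order (the member's QUALITY, which
exactness does not need); the OMF integrators (same certificate, `GaugeFTHMCSymmetricWord`);
SU(N) (the frozen-staple lemma is ready, the Haar volume form on SU(N) is not in Mathlib);
ergodicity; any number.
-/

noncomputable section

namespace Summit.Ventures.LatticeQCDFlow.Exactness

open Set Function MeasureTheory Summit.Ventures.LatticeQCDFlow.Theory2
open ProbabilityTheory ProbabilityTheory.Kernel
open Literature.MathematicalPhysics.QuantumFieldTheory
open scoped NNReal ENNReal

variable {d L : ℕ} {X : Type*}

/-! ## The sub-step is a certified coupling layer -/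

section Substep

variable [DecidableEq X] (χ : Site d L → X) [NeZero L]

/-- **The engine's masked U(1) Wilson-flow Euler sub-step is a certified coupling layer of the
gauge field.**  Proper colouring `χ` of the torus, direction `μ`, class `b`, step `ε` inside the
refusal rule `2(d−1)|ε| < 1`.  There is a measurable equivalence `F` of `GaugeConfig d L Circle`
whose forward map IS the sub-step computed from the full field — active links
`V(x,μ) ↦ V(x,μ) e^{iεZ_{x,μ}(V)}`, frozen links unchanged — with
`HasJacobian (⊗_e Haar) F (∏_{active} (1 − ε C_{x,μ}(V)))`, the exponential of the log-det the
engine books; the Jacobian is positive and measurable. -/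
theorem exists_measurableEquiv_u1WilsonFlowLOSubstep
    (hχ : ∀ (x : Site d L) (i : Fin d), χ (x.shift i) ≠ χ x) (μ : Fin d) (b : X) {ε : ℝ}
    (hε : |ε| * (2 * ((d - 1 : ℕ) : ℝ)) < 1) :
    ∃ F : GaugeConfig d L Circle ≃ᵐ GaugeConfig d L Circle,
      (⇑F = fun (V : GaugeConfig d L Circle) (e : Edge d L) => if e.2 = μ ∧ χ e.1 = b then
          V e * Circle.exp (ε * ∑ ν ∈ Finset.univ.erase e.2,
            (((plaquetteHolonomy V (e.1 - Pi.single ν 1) e.2 ν : Circle) : ℂ).im -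
              ((plaquetteHolonomy V e.1 e.2 ν : Circle) : ℂ).im)) else V e) ∧
      HasJacobian (Measure.pi fun _ : Edge d L => haarProbability Circle) F
        (fun V => ENNReal.ofReal (∏ a : {e : Edge d L // e.2 = μ ∧ χ e.1 = b},
          (1 - ε * ∑ ν ∈ Finset.univ.erase a.1.2,
            (((plaquetteHolonomy V a.1.1 a.1.2 ν : Circle) : ℂ).re +
              ((plaquetteHolonomy V (a.1.1 - Pi.single ν 1) a.1.2 ν : Circle) : ℂ).re)))) ∧
      (∀ V : GaugeConfig d L Circle, 0 < ∏ a : {e : Edge d L // e.2 = μ ∧ χ e.1 = b},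
          (1 - ε * ∑ ν ∈ Finset.univ.erase a.1.2,
            (((plaquetteHolonomy V a.1.1 a.1.2 ν : Circle) : ℂ).re +
              ((plaquetteHolonomy V (a.1.1 - Pi.single ν 1) a.1.2 ν : Circle) : ℂ).re))) ∧
      Measurable fun V : GaugeConfig d L Circle => ∏ a : {e : Edge d L // e.2 = μ ∧ χ e.1 = b},
          (1 - ε * ∑ ν ∈ Finset.univ.erase a.1.2,
            (((plaquetteHolonomy V a.1.1 a.1.2 ν : Circle) : ℂ).re +
              ((plaquetteHolonomy V (a.1.1 - Pi.single ν 1) a.1.2 ν : Circle) : ℂ).re)) := by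
  classical
  -- proof-local abbreviations: the filled field, the drift sum, the factor sum
  set EXT : {e : Edge d L // e.2 = μ ∧ χ e.1 = b} →
      ({e : Edge d L // ¬(e.2 = μ ∧ χ e.1 = b)} → Circle) → Circle → GaugeConfig d L Circle :=
    fun a y g j => if h : j.2 = μ ∧ χ j.1 = b then (if j = a.1 then g else 1) else y ⟨j, h⟩
    with hEXT
  set ZS : GaugeConfig d L Circle → Edge d L → ℝ := fun W e => ∑ ν ∈ Finset.univ.erase e.2,
      (((plaquetteHolonomy W (e.1 - Pi.single ν 1) e.2 ν : Circle) : ℂ).im -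
        ((plaquetteHolonomy W e.1 e.2 ν : Circle) : ℂ).im) with hZS
  set CS : GaugeConfig d L Circle → Edge d L → ℝ := fun W e => ∑ ν ∈ Finset.univ.erase e.2,
      (((plaquetteHolonomy W e.1 e.2 ν : Circle) : ℂ).re +
        ((plaquetteHolonomy W (e.1 - Pi.single ν 1) e.2 ν : Circle) : ℂ).re) with hCS
  have hcard : ∀ m : Fin d, (((Finset.univ.erase m).card : ℕ) : ℝ) = ((d - 1 : ℕ) : ℝ) :=
    fun m => by rw [Finset.card_erase_of_mem (Finset.mem_univ m), Finset.card_univ, Fintype.card_fin]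
  have hEXTa : ∀ a y g, EXT a y g a.1 = g := fun a y g => by
    simp only [hEXT]
    rw [dif_pos a.2, if_true]
  have hEXTf : ∀ a y g (j : Edge d L) (hj : ¬(j.2 = μ ∧ χ j.1 = b)), EXT a y g j = y ⟨j, hj⟩ :=
    fun a y g j hj => by
      simp only [hEXT]
      rw [dif_neg hj]
  -- locality of the rule and of the factor (frozen-staple lemma)
  have hu : ∀ (V W : GaugeConfig d L Circle) (i : Edge d L), (i.2 = μ ∧ χ i.1 = b) → V i = W i →
      (∀ j : Edge d L, ¬(j.2 = μ ∧ χ j.1 = b) → V j = W j) →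
      V i * Circle.exp (ε * ZS V i) = W i * Circle.exp (ε * ZS W i) := by
    intro V W i hi hVi hVW
    have h := (u1Substep_local χ hχ μ b hi hVi hVW).1
    change ZS V i = ZS W i at h
    rw [hVi, h]
  have hc : ∀ (V W : GaugeConfig d L Circle) (i : Edge d L), (i.2 = μ ∧ χ i.1 = b) → V i = W i →
      (∀ j : Edge d L, ¬(j.2 = μ ∧ χ j.1 = b) → V j = W j) → 1 - ε * CS V i = 1 - ε * CS W i := by
    intro V W i hi hVi hVW
    have h := (u1Substep_local χ hχ μ b hi hVi hVW).2
    change CS V i = CS W i at h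
    rw [h]
  -- calculus of the single-link lift family
  have hderiv : ∀ a y (θ : ℝ), HasDerivAt (fun θ : ℝ => θ + ε * ZS (EXT a y (Circle.exp θ)) a.1)
      (1 - ε * CS (EXT a y (Circle.exp θ)) a.1) θ := by
    intro a y θ
    have h := hasDerivAt_plaquetteLift (Finset.univ.erase a.1.2)
      (fun ν => plaquetteHolonomy (EXT a y 1) a.1.1 a.1.2 ν)
      (fun ν => plaquetteHolonomy (EXT a y 1) (a.1.1 - Pi.single ν 1) a.1.2 ν) ε θ
    refine (h.congr_of_eventuallyEq (Filter.Eventually.of_forall fun θ' => ?_)).congr_deriv ?_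
    · exact congrArg (fun t : ℝ => θ' + t) (u1Drift_ext_eq χ hχ a y (Circle.exp θ') ε).1
    · exact ((u1Drift_ext_eq χ hχ a y (Circle.exp θ) ε).2).symm
  have hpos : ∀ a y (θ : ℝ), 0 < 1 - ε * CS (EXT a y (Circle.exp θ)) a.1 := by
    intro a y θ
    exact (plaquetteLiftDeriv_pos (Finset.univ.erase a.1.2)
      (fun ν => plaquetteHolonomy (EXT a y 1) a.1.1 a.1.2 ν)
      (fun ν => plaquetteHolonomy (EXT a y 1) (a.1.1 - Pi.single ν 1) a.1.2 ν)
      (by rw [hcard]; exact hε) θ).trans_eq ((u1Drift_ext_eq χ hχ a y (Circle.exp θ) ε).2).symm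
  have hcont : ∀ a y, Continuous fun θ : ℝ => 1 - ε * CS (EXT a y (Circle.exp θ)) a.1 :=
    fun a y => (continuous_u1Factor a.1 ε).comp (continuous_ext χ a y)
  have hdeg : ∀ a y (θ : ℝ), (θ + 2 * Real.pi) + ε * ZS (EXT a y (Circle.exp (θ + 2 * Real.pi))) a.1
      = (θ + ε * ZS (EXT a y (Circle.exp θ)) a.1) + 2 * Real.pi := by
    intro a y θ
    rw [Circle.exp_add_two_pi]
    ring
  have hΦm : ∀ a, Measurable fun w : ℝ × ({e : Edge d L // ¬(e.2 = μ ∧ χ e.1 = b)} → Circle) =>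
      w.1 + ε * ZS (EXT a w.2 (Circle.exp w.1)) a.1 :=
    fun a => measurable_fst.add ((continuous_u1Drift a.1 ε).measurable.comp (measurable_ext χ a))
  have hΦ'm : ∀ a, Measurable fun w : ℝ × ({e : Edge d L // ¬(e.2 = μ ∧ χ e.1 = b)} → Circle) =>
      1 - ε * CS (EXT a w.2 (Circle.exp w.1)) a.1 :=
    fun a => (continuous_u1Factor a.1 ε).measurable.comp (measurable_ext χ a)
  have hmeasJ : Measurable fun V : GaugeConfig d L Circle =>
      ∏ a : {e : Edge d L // e.2 = μ ∧ χ e.1 = b}, (1 - ε * CS V a.1) :=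
    Finset.measurable_prod _ fun a _ => (continuous_u1Factor a.1 ε).measurable
  -- the single-link measurable equivalences, and what they do on the filled field
  obtain ⟨ψ, hψ, hψm, hψsm⟩ := exists_coupleEquiv_of_hasDerivAt_pos
    (p := fun e : Edge d L => e.2 = μ ∧ χ e.1 = b)
    (Φ := fun a y θ => θ + ε * ZS (EXT a y (Circle.exp θ)) a.1)
    (Φ' := fun a y θ => 1 - ε * CS (EXT a y (Circle.exp θ)) a.1) hderiv hpos hdeg hΦm
  have hψu : (fun a y g => (ψ a y g : Circle)) =
      fun a y g => EXT a y g a.1 * Circle.exp (ε * ZS (EXT a y g) a.1) := by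
    funext a y g
    obtain ⟨θ, rfl⟩ := Circle.exp_surjective g
    rw [hψ, Circle.exp_add, hEXTa]
  refine ⟨coupleEquiv ψ hψm hψsm, ?_, ?_, ?_, hmeasJ⟩
  · -- the forward map is the sub-step computed from the full field
    rw [coe_coupleEquiv, hψu]
    funext V
    exact coupleFun_maskedUpdate (p := fun e : Edge d L => e.2 = μ ∧ χ e.1 = b)
      (fun (W : GaugeConfig d L Circle) (i : Edge d L) => W i * Circle.exp (ε * ZS W i)) hu V
  · -- the certified Jacobian is the product of the booked factors
    have h1 := hasJacobian_coupleFun_circleGroup_of_degreeOne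
      (p := fun e : Edge d L => e.2 = μ ∧ χ e.1 = b)
      (Φ := fun a y θ => θ + ε * ZS (EXT a y (Circle.exp θ)) a.1)
      (Φ' := fun a y θ => 1 - ε * CS (EXT a y (Circle.exp θ)) a.1)
      hderiv hcont hpos hdeg hΦm hΦ'm (ψ := fun a y g => ψ a y g) hψ
      (jac := fun a y g => 1 - ε * CS (EXT a y g) a.1)
    have hJ := h1 fun a y θ => rfl
    have hjac : (fun U : GaugeConfig d L Circle => ENNReal.ofReal (coupleJac
        (fun e : Edge d L => e.2 = μ ∧ χ e.1 = b) (fun a y g => 1 - ε * CS (EXT a y g) a.1) U)) =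
        fun V => ENNReal.ofReal (∏ a : {e : Edge d L // e.2 = μ ∧ χ e.1 = b}, (1 - ε * CS V a.1)) :=
      funext fun U => congrArg ENNReal.ofReal (coupleJac_maskedUpdate
        (p := fun e : Edge d L => e.2 = μ ∧ χ e.1 = b)
        (fun (W : GaugeConfig d L Circle) (i : Edge d L) => 1 - ε * CS W i) hc U)
    change HasJacobian _ _ fun V : GaugeConfig d L Circle =>
      ENNReal.ofReal (∏ a : {e : Edge d L // e.2 = μ ∧ χ e.1 = b}, (1 - ε * CS V a.1))
    rw [coe_coupleEquiv, ← hjac]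
    exact hJ
  · -- positivity
    intro V
    refine Finset.prod_pos fun a _ => ?_
    obtain ⟨θ, hθ⟩ := Circle.exp_surjective (V a.1)
    change 0 < 1 - ε * CS V a.1
    rw [hc V (EXT a (fun f => V f) (Circle.exp θ)) a.1 a.2
      ((hEXTa a (fun f => V f) (Circle.exp θ)).trans hθ).symm
      (fun j hj => (hEXTf a (fun f => V f) (Circle.exp θ) j hj).symm)]
    exact hpos a (fun f => V f) θ

/-- **FT-HMC exactly as the engine runs it, through the masked U(1) Wilson-flow sub-step, is
exact.**  Gaussian momentum refresh, leapfrog with the link drift `V_e ← e^{icp_e} V_e` and ANY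
measurable force `g`, any number of steps `n`, flip, Metropolis on
`(S ∘ F − log ∏_{active}(1 − εC)) + Σ_e p_e²/2`, forget the momenta, report `F V`: for every
measurable action `S` the configuration kernel leaves `e^{−S} · ⊗_e Haar` invariant
(`GaugeFTHMCLeapfrog.u1_fthmc_leapfrog_gaussian_exact` with the certificate above). -/
theorem u1_fthmc_leapfrog_gaussian_exact_wilsonFlowLOSubstep
    (hχ : ∀ (x : Site d L) (i : Fin d), χ (x.shift i) ≠ χ x) (μ : Fin d) (b : X) {ε : ℝ}
    (hε : |ε| * (2 * ((d - 1 : ℕ) : ℝ)) < 1)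
    {S : GaugeConfig d L Circle → ℝ} (hS : Measurable S) (c : ℝ)
    {g : GaugeConfig d L Circle → (Edge d L → ℝ)} (hg : Measurable g) (n : ℕ) :
    ∃ F : GaugeConfig d L Circle ≃ᵐ GaugeConfig d L Circle,
      (⇑F = fun (V : GaugeConfig d L Circle) (e : Edge d L) => if e.2 = μ ∧ χ e.1 = b then
          V e * Circle.exp (ε * ∑ ν ∈ Finset.univ.erase e.2,
            (((plaquetteHolonomy V (e.1 - Pi.single ν 1) e.2 ν : Circle) : ℂ).im -
              ((plaquetteHolonomy V e.1 e.2 ν : Circle) : ℂ).im)) else V e) ∧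
      Invariant
        (conjKernel
          (refreshUpdate
            (involMH
              (⇑((flip : Equiv.Perm (GaugeConfig d L Circle × (Edge d L → ℝ))) *
                  leapfrog (mulDrift fun p : Edge d L → ℝ => fun i => Circle.exp (c * p i)) g ^ n))
              (measurable_flip_leapfrog_pow (measurable_mulDrift (measurable_circleDrift c)) hg n)
              fun z : GaugeConfig d L Circle × (Edge d L → ℝ) =>
                (S (F z.1) - Real.log (∏ a : {e : Edge d L // e.2 = μ ∧ χ e.1 = b},
          (1 - ε * ∑ ν ∈ Finset.univ.erase a.1.2,
            (((plaquetteHolonomy z.1 a.1.1 a.1.2 ν : Circle) : ℂ).re +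
              ((plaquetteHolonomy z.1 (a.1.1 - Pi.single ν 1) a.1.2 ν : Circle) : ℂ).re)))) + ∑ i, z.2 i ^ 2 / 2)
            ((((volume : Measure (Edge d L → ℝ)).withDensity
                  fun p => ENNReal.ofReal (Real.exp (-(∑ i, p i ^ 2 / 2)))) Set.univ)⁻¹ •
              (volume : Measure (Edge d L → ℝ)).withDensity
                fun p => ENNReal.ofReal (Real.exp (-(∑ i, p i ^ 2 / 2)))))
          F)
        ((Measure.pi fun _ : Edge d L => haarProbability Circle).withDensity
          fun U => ENNReal.ofReal (Real.exp (-S U))) := by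
  obtain ⟨F, hF, hJ, hpos, hmeas⟩ := exists_measurableEquiv_u1WilsonFlowLOSubstep χ hχ μ b hε
  exact ⟨F, hF, u1_fthmc_leapfrog_gaussian_exact hpos hmeas hJ hS c hg n⟩

end Substep

/-! ## The member: a schedule of sub-steps -/

section Member

variable [DecidableEq X] (χ : Site d L → X) [NeZero L]

/-- **Any schedule of sub-steps is a list of certified layers.**  For a list of `(direction,
class)` pairs — the engine's is sweep-major, `μ`-major, parity even then odd, repeated `n_sweeps`
times — there is a list of (measurable equivalence, Jacobian) pairs whose forward maps ARE the
sub-steps and whose Jacobians ARE the booked products, each certified, positive and measurable: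
the hypotheses of `hasJacobian_foldr_trans` / `thmc_hmc_exact_foldr` /
`u1_fthmc_leapfrog_gaussian_exact_foldr` for the whole leading-order member. -/
theorem exists_layers_u1WilsonFlowLO
    (hχ : ∀ (x : Site d L) (i : Fin d), χ (x.shift i) ≠ χ x) {ε : ℝ}
    (hε : |ε| * (2 * ((d - 1 : ℕ) : ℝ)) < 1) (sched : List (Fin d × X)) :
    ∃ layers : List ((GaugeConfig d L Circle ≃ᵐ GaugeConfig d L Circle) ×
        (GaugeConfig d L Circle → ℝ)),
      layers.map (fun Ly => ((Ly.1 : GaugeConfig d L Circle → GaugeConfig d L Circle), Ly.2)) = sched.map (fun s =>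
        ((fun (V : GaugeConfig d L Circle) (e : Edge d L) => if e.2 = s.1 ∧ χ e.1 = s.2 then
          V e * Circle.exp (ε * ∑ ν ∈ Finset.univ.erase e.2,
            (((plaquetteHolonomy V (e.1 - Pi.single ν 1) e.2 ν : Circle) : ℂ).im -
              ((plaquetteHolonomy V e.1 e.2 ν : Circle) : ℂ).im)) else V e),
         fun V : GaugeConfig d L Circle => ∏ a : {e : Edge d L // e.2 = s.1 ∧ χ e.1 = s.2},
          (1 - ε * ∑ ν ∈ Finset.univ.erase a.1.2,
            (((plaquetteHolonomy V a.1.1 a.1.2 ν : Circle) : ℂ).re +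
              ((plaquetteHolonomy V (a.1.1 - Pi.single ν 1) a.1.2 ν : Circle) : ℂ).re)))) ∧
      (∀ Ly ∈ layers, ∀ V, 0 < Ly.2 V) ∧ (∀ Ly ∈ layers, Measurable Ly.2) ∧
      (∀ Ly ∈ layers, HasJacobian (Measure.pi fun _ : Edge d L => haarProbability Circle) Ly.1
        fun V => ENNReal.ofReal (Ly.2 V)) := by
  induction sched with
  | nil => exact ⟨[], by simp, by simp, by simp, by simp⟩
  | cons s rest ih =>
    obtain ⟨layers, hmap, hpos, hmeas, hjac⟩ := ih
    obtain ⟨F, hF, hJ, hFpos, hFmeas⟩ :=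
      exists_measurableEquiv_u1WilsonFlowLOSubstep χ hχ s.1 s.2 hε
    refine ⟨(F, fun V : GaugeConfig d L Circle => ∏ a : {e : Edge d L // e.2 = s.1 ∧ χ e.1 = s.2},
          (1 - ε * ∑ ν ∈ Finset.univ.erase a.1.2,
            (((plaquetteHolonomy V a.1.1 a.1.2 ν : Circle) : ℂ).re +
              ((plaquetteHolonomy V (a.1.1 - Pi.single ν 1) a.1.2 ν : Circle) : ℂ).re))) :: layers,
      ?_, ?_, ?_, ?_⟩
    · rw [List.map_cons, List.map_cons, hmap, hF]
    · intro Ly hLy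
      rcases List.mem_cons.mp hLy with rfl | h
      exacts [hFpos, hpos Ly h]
    · intro Ly hLy
      rcases List.mem_cons.mp hLy with rfl | h
      exacts [hFmeas, hmeas Ly h]
    · intro Ly hLy
      rcases List.mem_cons.mp hLy with rfl | h
      exacts [hJ, hjac Ly h]

/-- **FT-HMC exactly as the engine runs it, through the whole leading-order member (any schedule
of masked U(1) Wilson-flow sub-steps, with its running log-det), is exact**: for every measurable
action `S`, drift coefficient `c`, measurable force `g` and trajectory length `n`, the reported
configuration kernel leaves `e^{−S} · ⊗_e Haar` invariant
(`U1FTHMCMembers.u1_fthmc_leapfrog_gaussian_exact_foldr`). -/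
theorem u1_fthmc_leapfrog_gaussian_exact_wilsonFlowLO
    (hχ : ∀ (x : Site d L) (i : Fin d), χ (x.shift i) ≠ χ x) {ε : ℝ}
    (hε : |ε| * (2 * ((d - 1 : ℕ) : ℝ)) < 1) (sched : List (Fin d × X))
    {S : GaugeConfig d L Circle → ℝ} (hS : Measurable S) (c : ℝ)
    {g : GaugeConfig d L Circle → (Edge d L → ℝ)} (hg : Measurable g) (n : ℕ) :
    ∃ layers : List ((GaugeConfig d L Circle ≃ᵐ GaugeConfig d L Circle) ×
        (GaugeConfig d L Circle → ℝ)),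
      layers.map (fun Ly => ((Ly.1 : GaugeConfig d L Circle → GaugeConfig d L Circle), Ly.2)) = sched.map (fun s =>
        ((fun (V : GaugeConfig d L Circle) (e : Edge d L) => if e.2 = s.1 ∧ χ e.1 = s.2 then
          V e * Circle.exp (ε * ∑ ν ∈ Finset.univ.erase e.2,
            (((plaquetteHolonomy V (e.1 - Pi.single ν 1) e.2 ν : Circle) : ℂ).im -
              ((plaquetteHolonomy V e.1 e.2 ν : Circle) : ℂ).im)) else V e),
         fun V : GaugeConfig d L Circle => ∏ a : {e : Edge d L // e.2 = s.1 ∧ χ e.1 = s.2},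
          (1 - ε * ∑ ν ∈ Finset.univ.erase a.1.2,
            (((plaquetteHolonomy V a.1.1 a.1.2 ν : Circle) : ℂ).re +
              ((plaquetteHolonomy V (a.1.1 - Pi.single ν 1) a.1.2 ν : Circle) : ℂ).re)))) ∧
      Invariant
        (conjKernel
          (refreshUpdate
            (involMH
              (⇑((flip : Equiv.Perm (GaugeConfig d L Circle × (Edge d L → ℝ))) *
                  leapfrog (mulDrift fun p : Edge d L → ℝ => fun i => Circle.exp (c * p i)) g ^ n))
              (measurable_flip_leapfrog_pow (measurable_mulDrift (measurable_circleDrift c)) hg n)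
              fun z : GaugeConfig d L Circle × (Edge d L → ℝ) =>
                (S (layers.foldr (fun Ly (G : GaugeConfig d L Circle ≃ᵐ GaugeConfig d L Circle) =>
                    Ly.1.trans G) (MeasurableEquiv.refl (GaugeConfig d L Circle)) z.1) -
                  Real.log (layers.foldr (fun Ly K => fun V => Ly.2 V * K (Ly.1 V))
                    (fun _ => (1 : ℝ)) z.1)) +
                  ∑ i, z.2 i ^ 2 / 2)
            ((((volume : Measure (Edge d L → ℝ)).withDensity
                  fun p => ENNReal.ofReal (Real.exp (-(∑ i, p i ^ 2 / 2)))) Set.univ)⁻¹ •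
              (volume : Measure (Edge d L → ℝ)).withDensity
                fun p => ENNReal.ofReal (Real.exp (-(∑ i, p i ^ 2 / 2)))))
          (layers.foldr (fun Ly (G : GaugeConfig d L Circle ≃ᵐ GaugeConfig d L Circle) =>
              Ly.1.trans G) (MeasurableEquiv.refl (GaugeConfig d L Circle))))
        ((Measure.pi fun _ : Edge d L => haarProbability Circle).withDensity
          fun U => ENNReal.ofReal (Real.exp (-S U))) := by
  obtain ⟨layers, hmap, hpos, hmeas, hjac⟩ := exists_layers_u1WilsonFlowLO χ hχ hε sched
  exact ⟨layers, hmap, u1_fthmc_leapfrog_gaussian_exact_foldr layers hpos hmeas hjac hS c hg n⟩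

end Member

end Summit.Ventures.LatticeQCDFlow.Exactness
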